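import Summits.HodgeConjecture.HodgeConjecture.Theorems.Ring2AbelianAllAndreOddCellDefs
import HarnessLib

/-!
# Ring 2 · AbelianAll — ANDRÉ AXIS, PART U — U-c: THE `K`-TOP LINES OF A MEMBER — characters `χ±`, the joint eigenclass LINES `⋀ᴺV_±` in degree `N = dim`, conjugation (Sketch §F7, §G, §H1–H2, AV level)

HONEST FRAMING (page 1, verbatim): **research route, not a corollary; conditional on HC_CM plus one named minimal statement.** Cell line:
research route conditional on HC_CM; not a corollary; Q11.4-sentence-2 already refuted in dim ≥ 3. Nothing in this file proves a case of
the Hodge conjecture or `B(X)` for a named `X`; `HC_CM`, `HC_AV` and the global nodes are ABSENT; every bracket / residual / crux below is a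
HYPOTHESIS wherever used (`@[conjecture] def`), never asserted. Item `Theses.RankFourFaces.CMToAbelian` (stmt-16267) stays OPEN; N104 untouched.

PROVENANCE. Seat `pub-hodge-ring2-ab-andre-2`, gen 52 (PART U: the ODD CELL at relative dimension three on the André axis). The
mathematics of this part was PLANNED AND KERNEL-CHECKED AT MEMO LEVEL by the (lapsed) ideation seat vhodge-p6 (gens 0–6, 2026-08-25) in
`run/shared/lean/pub/vhodge/memos/ROUTE-P6-g4-Sketch.lean` (sha16 a5719f36; 2548 lines; farm rc 0, 0 sorries, 0 errors; re-checked by this seat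
2026-08-26T02:34Z, 60 s) on top of this seat's parts XXXV–T; it never entered the tree (the planner seat files nothing; director-hodge ruling
2026-08-25T21:26:55Z «(B) LAPSE with (A) banked»: landing the Sketch's statement vocabulary + kernel chain as Theorems files is cost item (A)(1)
of the banked ladder rung H1d′ «Lefschetz B for compact abelian-threefold pencils, odd cell»). This file is that landing for the sections named
in its title: declarations VERBATIM from the Sketch (namespace moved from `…VHodgeP6` to `…Ring2.AbelianAll.OddCell`, the memo-level `abbrev
FirstTarget` replaced by the constant `LefschetzBOddPencilsRelDimThree`, lint repairs, sections re-cut to the tree's 400-line files), credited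
decl by decl to the memo; the seat's own additions are marked «(ab-andre-2, gen 52)».

CONTENT (abelian-variety level, no pencil; theorems only; Sketch lines 1081–1104, 1302–1471, 1567–1604, 1813–1817, 2020–2053): the algebra of
the characters `chiPlus d k` / `chiMinus d k` (part U-a); `map_eq_smul_of_mem_pullbackEigenclasses`; **the joint eigenclasses of
character `(x + yμ)^N`, `μ = ±i√d`, in degree `N = dim A` form a LINE** (`finrank_pullbackEigenclasses_pow_eq_one_anyDegree`, any parity of `N`;
van Geemen 6.12's `⋀^N W`), `exists_ne_zero_mem_pullbackEigenclasses_neg_chiPlus`; conjugation swaps `Eig_{χ₊}` and `Eig_{χ₋}` and they meet in `0`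
in odd degree; the two lines `finrank_pullbackEigenclasses_chiPlus/chiMinus_eq_one`. EDGE LABELS: K (fact-free; tree: `hasExteriorCohomologyH1_complexPoints`).
-/

noncomputable section

namespace Summit.HodgeConjecture.HodgeConjecture.Ring2.AbelianAll.OddCell

set_option linter.dupNamespace false

open CategoryTheory CategoryTheory.Limits AlgebraicGeometry MonoidalCategory CartesianMonoidalCategory
open Literature.AlgebraicGeometry Literature.AlgebraicGeometry.Motives
open Literature.AlgebraicGeometry.HodgeTheory
open Literature.AlgebraicTopology.SingularHomology
open Literature.AlgebraicGeometry.VanGeemen1994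
open Literature.AlgebraicGeometry.Andre1996 (compactPencil_dim_eq_of_iso)
open Summit.HodgeConjecture.HodgeConjecture
open Summit.HodgeConjecture.HodgeConjecture.Theses
open Summit.HodgeConjecture.HodgeConjecture.Ring2.AbelianAll
open Summit.HodgeConjecture.HodgeConjecture.Theorems (deg_fiberGysin_aux exists_fibreClassInverse_deg_of_lefschetzBCompactPencils)
open scoped MonObj

variable {𝒳 S : SchemeOver ℂ} {f : 𝒳 ⟶ S}

/-- `χ₊ · χ₊ = χ₊` of double degree. [folklore] -/
theorem chiPlus_mul_chiPlus (d k : ℕ) : (fun x y : ℕ ↦ chiPlus d k x y * chiPlus d k x y) = chiPlus d (2 * k) := by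
  funext x y
  simp only [chiPlus]
  rw [← pow_add, ← two_mul]

/-- In ODD degree `k` the endomorphism `φ^*` alone separates `⋀ᵏV₊` from `⋀ᵏV₋`: `(i√d)^k ≠ (−i√d)^k`. [folklore] -/
theorem chiPlus_zero_one_sub_chiMinus_zero_one_ne_zero {d k : ℕ} (hd : 0 < d) (hk : Odd k) :
    chiPlus d k 0 1 - chiMinus d k 0 1 ≠ 0 := by
  have hz : (Complex.I * (Real.sqrt d : ℂ)) ≠ 0 :=
    mul_ne_zero Complex.I_ne_zero (Complex.ofReal_ne_zero.2 (Real.sqrt_ne_zero'.2 (by exact_mod_cast hd)))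
  simp only [chiPlus, chiMinus, Nat.cast_zero, Nat.cast_one, zero_add, zero_sub, one_mul]
  rw [Odd.neg_pow hk, sub_neg_eq_add, ← two_mul]
  exact mul_ne_zero two_ne_zero (pow_ne_zero _ hz)

/-- `φ^* c = χ(0,1) · c` on a `χ`-eigenclass (`x = 0`, `y = 1`). [cite: vanGeemen1994HodgeAV, 4.8–4.9] -/
theorem map_eq_smul_of_mem_pullbackEigenclasses {B : AbelianVariety ℂ} {ψ : B ⟶ B} {k : ℕ} {χ : ℕ → ℕ → ℂ}
    {c : complexBetti B.X k} (hc : c ∈ pullbackEigenclasses B ψ k χ) : complexBetti.map ψ.hom.hom.hom k c = χ 0 1 • c := by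
  have h := (mem_pullbackEigenclasses_iff.1 hc) 0 1
  simp only [zero_smul, one_smul, zero_add] at h
  exact h

/-- **The joint eigenclasses of character `(x + yμ)^N`, `μ = ±i√d`, in degree `N` form a LINE when `b₁(A) = 2N`** (any parity of
`N`; the tree's `finrank_pullbackEigenclasses_pow_eq_one` is the case `N = 2n`, same proof). [cite: vanGeemen1994HodgeAV, 4.9 and proof of Thm. 6.12] -/
theorem finrank_pullbackEigenclasses_pow_eq_one_anyDegree {N d : ℕ} {A : AbelianVariety ℂ}
    (hΛ : HasExteriorCohomologyH1 ℂ (Motives.ComplexPoints A.X))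
    (hb₁ : Module.finrank ℂ (complexBetti A.X 1) = 2 * N) (hd : 0 < d) {φ : A ⟶ A}
    (hφ : φ ≫ φ = -(d • 𝟙 A)) {mu : ℂ}
    (hmu : mu = Complex.I * (Real.sqrt d : ℂ) ∨ mu = -(Complex.I * (Real.sqrt d : ℂ))) :
    Module.finrank ℂ (pullbackEigenclasses A φ (N)
      fun x y => ((x : ℂ) + (y : ℂ) * mu) ^ (N)) = 1 := by
  classical
  haveI := finite_complexBetti_abelianVariety A 1
  set T := (complexBetti.map φ.hom.hom.hom 1).hom with hT
  have hmu0 : mu ≠ 0 := by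
    rcases hmu with rfl | rfl
    · exact I_mul_sqrt_ne_zero hd
    · exact neg_ne_zero.mpr (I_mul_sqrt_ne_zero hd)
  -- `H¹ = V_mu ⊕ V_{-mu}`, both of dimension `2n`
  have hps : Module.finrank ℂ (Module.End.eigenspace T (Complex.I * (Real.sqrt d : ℂ))) = N := by
    have h := two_mul_finrank_eigenspace_eq hd hφ
    rw [hb₁] at h
    change 2 * Module.finrank ℂ (Module.End.eigenspace T (Complex.I * (Real.sqrt d : ℂ))) =
      2 * (N) at h
    omega
  have hqs : Module.finrank ℂ (Module.End.eigenspace T (-(Complex.I * (Real.sqrt d : ℂ)))) = N := by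
    have h := finrank_eigenspace_eq_finrank_eigenspace_neg hd hφ
    change Module.finrank ℂ (Module.End.eigenspace T (Complex.I * (Real.sqrt d : ℂ))) =
      Module.finrank ℂ (Module.End.eigenspace T (-(Complex.I * (Real.sqrt d : ℂ)))) at h
    rw [← h, hps]
  have hcompl : IsCompl (Module.End.eigenspace T mu) (Module.End.eigenspace T (-mu)) := by
    rcases hmu with rfl | rfl
    · exact isCompl_eigenspace_eigenspace_neg hd hφ
    · rw [neg_neg]; exact (isCompl_eigenspace_eigenspace_neg hd hφ).symm
  have hp : Module.finrank ℂ (Module.End.eigenspace T mu) = N := by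
    rcases hmu with rfl | rfl
    · exact hps
    · exact hqs
  have hq : Module.finrank ℂ (Module.End.eigenspace T (-mu)) = N := by
    rcases hmu with rfl | rfl
    · exact hqs
    · rw [neg_neg]; exact hps
  -- an eigenbasis of `H¹`, the `mu`-vectors first
  let bp := Module.finBasisOfFinrankEq ℂ (Module.End.eigenspace T mu) hp
  let bm := Module.finBasisOfFinrankEq ℂ (Module.End.eigenspace T (-mu)) hq
  let b₀ : Module.Basis (Fin (N) ⊕ Fin (N)) ℂ (complexBetti A.X 1) :=
    (bp.prod bm).map (Submodule.prodEquivOfIsCompl _ _ hcompl)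
  let b : Module.Basis (Fin (N + N)) ℂ (complexBetti A.X 1) := b₀.reindex finSumFinEquiv
  let lam : Fin (N + N) → ℂ := fun i =>
    Sum.elim (fun _ => mu) (fun _ => -mu) (finSumFinEquiv.symm i)
  have hlam : ∀ i, lam i = mu ∨ lam i = -mu := fun i => by
    change Sum.elim (fun _ => mu) (fun _ => -mu) (finSumFinEquiv.symm i) = mu ∨
      Sum.elim (fun _ => mu) (fun _ => -mu) (finSumFinEquiv.symm i) = -mu
    rcases finSumFinEquiv.symm i with k | k
    · exact Or.inl rfl
    · exact Or.inr rfl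
  have hb_mem : ∀ i, b i ∈ Module.End.eigenspace T (lam i) := by
    intro i
    rw [Module.Basis.reindex_apply]
    change b₀ (finSumFinEquiv.symm i) ∈
      Module.End.eigenspace T (Sum.elim (fun _ => mu) (fun _ => -mu) (finSumFinEquiv.symm i))
    rcases finSumFinEquiv.symm i with k | k
    · simp only [Sum.elim_inl, b₀, Module.Basis.map_apply, Module.Basis.prod_apply, Function.comp_apply,
        LinearMap.inl_apply, Submodule.coe_prodEquivOfIsCompl', Submodule.coe_zero, add_zero]
      exact (bp k).2
    · simp only [Sum.elim_inr, b₀, Module.Basis.map_apply, Module.Basis.prod_apply, Function.comp_apply,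
        LinearMap.inr_apply, Submodule.coe_prodEquivOfIsCompl', Submodule.coe_zero, zero_add]
      exact (bm k).2
  -- the wedge basis of `H²ⁿ` and the action of the test endomorphisms on it
  let Bw : Module.Basis (Set.powersetCard (Fin (N + N)) (N)) ℂ (complexBetti A.X (N)) :=
    (b.exteriorPower (N)).map (hΛ.equiv (N))
  have hBw : ∀ S, Bw S = cupPowOne ℂ (Motives.ComplexPoints A.X) (N)
      (b ∘ (Set.powersetCard.ofFinEmbEquiv.symm S)) := by
    intro S
    change hΛ.equiv (N) ((b.exteriorPower (N)) S) = _
    rw [exteriorPower.basis_apply, HasExteriorCohomologyH1.equiv_apply, exteriorPower.ιMulti_family,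
      wedgeToCup_ιMulti]
  have hact : ∀ (p : ℕ × ℕ) (S : Set.powersetCard (Fin (N + N)) (N)),
      (complexBetti.map (p.1 • 𝟙 A + p.2 • φ).hom.hom.hom (N)).hom (Bw S) =
        (∏ i : Fin (N), ((p.1 : ℂ) + (p.2 : ℂ) * lam (Set.powersetCard.ofFinEmbEquiv.symm S i))) •
          Bw S := by
    rintro ⟨x, y⟩ S
    rw [hBw]
    change singularCohomology.map ℂ ℂ
      (Motives.AlgPoints.mapContinuous (L := ℂ) (x • 𝟙 A + y • φ).hom.hom.hom) (N)
        (cupPowOne ℂ _ (N) _) = _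
    rw [map_cupPowOne]
    have e : (fun i => singularCohomology.map ℂ ℂ
        (Motives.AlgPoints.mapContinuous (L := ℂ) (x • 𝟙 A + y • φ).hom.hom.hom) 1
          ((b ∘ (Set.powersetCard.ofFinEmbEquiv.symm S)) i)) =
        fun i => ((x : ℂ) + (y : ℂ) * lam (Set.powersetCard.ofFinEmbEquiv.symm S i)) •
          (b ∘ (Set.powersetCard.ofFinEmbEquiv.symm S)) i := by
      funext i
      exact complexBetti_map_nsmul_id_add_nsmul_one_of_mem_eigenspace (hb_mem _) x y
    rw [e, MultilinearMap.map_smul_univ]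
  -- the distinguished index: the `2n` vectors of eigenvalue `mu`
  let S₀ : Set.powersetCard (Fin (N + N)) (N) :=
    Set.powersetCard.ofFinEmbEquiv (Fin.castAddOrderEmb (N))
  have hS₀ : ∀ i : Fin (N + N), i ∈ S₀ ↔ ∃ k : Fin (N), Fin.castAdd (N) k = i := by
    intro i
    rw [Set.powersetCard.mem_ofFinEmbEquiv_iff_mem_range]
    rfl
  have hlam_pos : ∀ i, i ∈ S₀ → lam i = mu := by
    intro i hi
    obtain ⟨k, rfl⟩ := (hS₀ i).1 hi
    change Sum.elim (fun _ => mu) (fun _ => -mu) (finSumFinEquiv.symm (Fin.castAdd (N) k)) = mu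
    rw [finSumFinEquiv_symm_apply_castAdd, Sum.elim_inl]
  have hlam_neg : ∀ i, i ∉ S₀ → lam i = -mu := by
    intro i hi
    change Sum.elim (fun _ => mu) (fun _ => -mu) (finSumFinEquiv.symm i) = -mu
    generalize hj : finSumFinEquiv.symm i = j
    rcases j with k | k
    · exfalso
      refine hi ((hS₀ i).2 ⟨k, ?_⟩)
      rw [← finSumFinEquiv_apply_left, ← hj, Equiv.apply_symm_apply]
    · rfl
  -- the characters `∏ (x + y λᵢ)` match `(x + ymu)²ⁿ` only at `S₀`
  have hχ : ∀ S : Set.powersetCard (Fin (N + N)) (N),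
      ((fun p : ℕ × ℕ => ∏ i : Fin (N),
          ((p.1 : ℂ) + (p.2 : ℂ) * lam (Set.powersetCard.ofFinEmbEquiv.symm S i))) =
        fun p : ℕ × ℕ => ((p.1 : ℂ) + (p.2 : ℂ) * mu) ^ (N)) ↔ S = S₀ := by
    intro S
    constructor
    · intro h
      by_contra hne
      obtain ⟨i, hiS, hiS₀⟩ := (Set.powersetCard.exists_mem_notMem_iff_ne S S₀).1 hne
      obtain ⟨k₀, hk₀⟩ : i ∈ Set.range (Set.powersetCard.ofFinEmbEquiv.symm S) :=
        (Set.powersetCard.mem_range_ofFinEmbEquiv_symm_iff_mem S i).2 hiS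
      have hneg : ∃ k, (lam ∘ Set.powersetCard.ofFinEmbEquiv.symm S) k = -mu :=
        ⟨k₀, by rw [Function.comp_apply, hk₀]; exact hlam_neg i hiS₀⟩
      obtain ⟨x, y, hxy⟩ := exists_prod_natCast_add_mul_ne_pow hmu0
        (lam ∘ Set.powersetCard.ofFinEmbEquiv.symm S) (fun k => hlam _) hneg
      exact hxy (congrFun h (x, y))
    · rintro rfl
      funext p
      rw [Finset.prod_congr rfl (fun i _ => by
        rw [hlam_pos _ ((Set.powersetCard.mem_range_ofFinEmbEquiv_symm_iff_mem S₀ _).1 ⟨i, rfl⟩)]),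
        Finset.prod_const, Finset.card_univ, Fintype.card_fin]
  -- the joint eigenclass space is the line through `Bw S₀`
  have key : (pullbackEigenclasses A φ (N) fun x y => ((x : ℂ) + (y : ℂ) * mu) ^ (N)) =
      ℂ ∙ Bw S₀ := by
    ext c
    rw [mem_pullbackEigenclasses_iff]
    have hiff := forall_apply_eq_smul_iff_mem_span_singleton (P := ℕ × ℕ) Bw
      (fun p => (complexBetti.map (p.1 • 𝟙 A + p.2 • φ).hom.hom.hom (N)).hom)
      (fun S p => ∏ i : Fin (N),
        ((p.1 : ℂ) + (p.2 : ℂ) * lam (Set.powersetCard.ofFinEmbEquiv.symm S i)))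
      hact (fun p => ((p.1 : ℂ) + (p.2 : ℂ) * mu) ^ (N)) S₀ hχ c
    rw [← hiff]
    exact ⟨fun h p => h p.1 p.2, fun h x y => h (x, y)⟩
  rw [key, finrank_span_singleton (Bw.ne_zero S₀)]

/-- **(R2) of the g3 residual, DISCHARGED**: for an abelian variety `A` of dimension `N` with `φ ≫ φ = -d`, `d ≥ 1`, there is a non-zero
class in `H^N(A(ℂ); ℂ)` in the `χ₊ = (x + iy√d)^N`-eigenclasses of `−φ` (i.e. in `⋀^N V₋(φ)`), fact-free
(`Motives.AbelianVariety.hasExteriorCohomologyH1_complexPoints`, `…finrank_complexBetti_one`). [cite: vanGeemen1994HodgeAV, 4.9] -/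
theorem exists_ne_zero_mem_pullbackEigenclasses_neg_chiPlus {N d : ℕ} {A : AbelianVariety ℂ} (hA : A.dim = N) (hd : 0 < d)
    {φ : A ⟶ A} (hφ : φ ≫ φ = -(d • 𝟙 A)) :
    ∃ α : complexBetti A.X N, α ∈ pullbackEigenclasses A (-φ) N (chiPlus d N) ∧ α ≠ 0 := by
  have hψ : (-φ) ≫ (-φ) = -(d • 𝟙 A) := by rw [Preadditive.neg_comp_neg]; exact hφ
  have hb₁ : Module.finrank ℂ (complexBetti A.X 1) = 2 * N := by
    rw [Motives.AbelianVariety.finrank_complexBetti_one, hA]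
  have e : chiPlus d N = fun x y : ℕ ↦ ((x : ℂ) + (y : ℂ) * (Complex.I * (Real.sqrt d : ℂ))) ^ N := by
    funext x y; simp only [chiPlus, mul_assoc]
  have h1 : Module.finrank ℂ (pullbackEigenclasses A (-φ) N (chiPlus d N)) = 1 := by
    rw [e]
    exact finrank_pullbackEigenclasses_pow_eq_one_anyDegree (Motives.AbelianVariety.hasExteriorCohomologyH1_complexPoints A) hb₁ hd hψ
      (Or.inl rfl)
  haveI : Nontrivial (pullbackEigenclasses A (-φ) N (chiPlus d N)) := Module.nontrivial_of_finrank_eq_succ h1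
  obtain ⟨⟨α, hα⟩, hα0⟩ := exists_ne (0 : pullbackEigenclasses A (-φ) N (chiPlus d N))
  exact ⟨α, hα, fun h ↦ hα0 (Subtype.ext h)⟩

/-- **§H1. Conjugation maps `Eig_{χ₋}` into `Eig_{χ₊}`** (`conj (x − iy√d)^k = (x + iy√d)^k`; the tree's `conjClass_mem_pullbackEigenclasses`).
[cite: vanGeemen1994HodgeAV, proof of Lemma 5.2 (6)] [cite: VoisinHodgeI2002, Cor. 6.12] -/
theorem conjClass_mem_pullbackEigenclasses_chiPlus_of_chiMinus {B : AbelianVariety ℂ} {ψ : B ⟶ B} {k d : ℕ}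
    {c : complexBetti B.X k} (hc : c ∈ pullbackEigenclasses B ψ k (chiMinus d k)) :
    conjClass (Motives.ComplexPoints B.X) k c ∈ pullbackEigenclasses B ψ k (chiPlus d k) := by
  have h := conjClass_mem_pullbackEigenclasses hc
  have e : (fun x y => starRingEnd ℂ (chiMinus d k x y)) = chiPlus d k := by
    funext x y
    simp only [chiMinus, chiPlus, map_pow, starRingEnd_natCast_sub_mul_I_mul_sqrt]
  rwa [e] at h

/-- **§H1′. Conjugation maps `Eig_{χ₊}` into `Eig_{χ₋}`.** [cite: vanGeemen1994HodgeAV, proof of Lemma 5.2 (6)] [cite: VoisinHodgeI2002, Cor. 6.12] -/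
theorem conjClass_mem_pullbackEigenclasses_chiMinus_of_chiPlus {B : AbelianVariety ℂ} {ψ : B ⟶ B} {k d : ℕ}
    {c : complexBetti B.X k} (hc : c ∈ pullbackEigenclasses B ψ k (chiPlus d k)) :
    conjClass (Motives.ComplexPoints B.X) k c ∈ pullbackEigenclasses B ψ k (chiMinus d k) := by
  have h := conjClass_mem_pullbackEigenclasses hc
  have e : (fun x y => starRingEnd ℂ (chiPlus d k x y)) = chiMinus d k := by
    funext x y
    simp only [chiMinus, chiPlus, map_pow, starRingEnd_natCast_add_mul_I_mul_sqrt]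
  rwa [e] at h

/-- **§H2. In ODD degree the two `K`-top eigen-conditions are disjoint**: `Eig_{χ₊} ⊓ Eig_{χ₋} = ⊥` (`φ^* c = (i√d)^k c = (−i√d)^k c ⟹ c = 0`).
[cite: vanGeemen1994HodgeAV, 4.8–4.9] -/
theorem pullbackEigenclasses_chiPlus_inf_chiMinus_eq_bot {B : AbelianVariety ℂ} {ψ : B ⟶ B} {k d : ℕ} (hd : 0 < d) (hk : Odd k) :
    pullbackEigenclasses B ψ k (chiPlus d k) ⊓ pullbackEigenclasses B ψ k (chiMinus d k) = ⊥ := by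
  rw [eq_bot_iff]
  intro c hc
  obtain ⟨hp, hm⟩ := Submodule.mem_inf.1 hc
  have h1 := map_eq_smul_of_mem_pullbackEigenclasses hp
  have h2 := map_eq_smul_of_mem_pullbackEigenclasses hm
  rw [h1] at h2
  have h0 : (chiPlus d k 0 1 - chiMinus d k 0 1) • c = 0 := by rw [sub_smul, h2, sub_self]
  exact (Submodule.mem_bot ℂ).2 ((smul_eq_zero.1 h0).resolve_left (chiPlus_zero_one_sub_chiMinus_zero_one_ne_zero hd hk))

/-- `conj (c − c') = conj c − conj c'`. [folklore] -/
theorem conjClass_sub' {Y : Type*} [TopologicalSpace Y] {k : ℕ} (c c' : singularCohomology ℂ ℂ Y k) :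
    conjClass Y k (c - c') = conjClass Y k c - conjClass Y k c' := by
  rw [← conjClassEquiv_apply, ← conjClassEquiv_apply, ← conjClassEquiv_apply, map_sub]

/-- `χ₋ · χ₋ = χ₋` of double degree. [folklore] -/
theorem chiMinus_mul_chiMinus (d k : ℕ) : (fun x y : ℕ ↦ chiMinus d k x y * chiMinus d k x y) = chiMinus d (2 * k) := by
  funext x y
  simp only [chiMinus]
  rw [← pow_add, ← two_mul]

/-- The `χ₊`-eigenclasses of `φ` in degree `N = dim A` form a LINE (§G, `μ = i√d`). [cite: vanGeemen1994HodgeAV, 4.9] -/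
theorem finrank_pullbackEigenclasses_chiPlus_eq_one {N d : ℕ} {A : AbelianVariety ℂ} (hA : A.dim = N) (hd : 0 < d)
    {φ : A ⟶ A} (hφ : φ ≫ φ = -(d • 𝟙 A)) :
    Module.finrank ℂ (pullbackEigenclasses A φ N (chiPlus d N)) = 1 := by
  have hb₁ : Module.finrank ℂ (complexBetti A.X 1) = 2 * N := by
    rw [Motives.AbelianVariety.finrank_complexBetti_one, hA]
  have e : chiPlus d N = fun x y : ℕ ↦ ((x : ℂ) + (y : ℂ) * (Complex.I * (Real.sqrt d : ℂ))) ^ N := by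
    funext x y; simp only [chiPlus, mul_assoc]
  rw [e]
  exact finrank_pullbackEigenclasses_pow_eq_one_anyDegree (Motives.AbelianVariety.hasExteriorCohomologyH1_complexPoints A) hb₁ hd hφ
    (Or.inl rfl)

/-- The `χ₋`-eigenclasses of `φ` in degree `N = dim A` form a LINE (§G, `μ = −i√d`). [cite: vanGeemen1994HodgeAV, 4.9] -/
theorem finrank_pullbackEigenclasses_chiMinus_eq_one {N d : ℕ} {A : AbelianVariety ℂ} (hA : A.dim = N) (hd : 0 < d)
    {φ : A ⟶ A} (hφ : φ ≫ φ = -(d • 𝟙 A)) :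
    Module.finrank ℂ (pullbackEigenclasses A φ N (chiMinus d N)) = 1 := by
  have hb₁ : Module.finrank ℂ (complexBetti A.X 1) = 2 * N := by
    rw [Motives.AbelianVariety.finrank_complexBetti_one, hA]
  have e : chiMinus d N = fun x y : ℕ ↦ ((x : ℂ) + (y : ℂ) * (-(Complex.I * (Real.sqrt d : ℂ)))) ^ N := by
    funext x y; simp only [chiMinus, mul_neg, mul_assoc, sub_eq_add_neg]
  rw [e]
  exact finrank_pullbackEigenclasses_pow_eq_one_anyDegree (Motives.AbelianVariety.hasExteriorCohomologyH1_complexPoints A) hb₁ hd hφ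
    (Or.inr rfl)

/-- In a line, every vector is a multiple of a given non-zero one. [folklore] -/
theorem exists_smul_eq_of_finrank_eq_one' {V : Type*} [AddCommGroup V] [Module ℂ V] {L : Submodule ℂ V}
    (hL : Module.finrank ℂ L = 1) {v : V} (hv : v ∈ L) (hv0 : v ≠ 0) {w : V} (hw : w ∈ L) : ∃ c : ℂ, c • v = w := by
  have hv0' : (⟨v, hv⟩ : L) ≠ 0 := fun h ↦ hv0 (congrArg Subtype.val h)
  obtain ⟨c, hc⟩ := (finrank_eq_one_iff_of_nonzero' (⟨v, hv⟩ : L) hv0').1 hL ⟨w, hw⟩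
  exact ⟨c, by simpa using congrArg Subtype.val hc⟩

end Summit.HodgeConjecture.HodgeConjecture.Ring2.AbelianAll.OddCell

end
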